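import Literature.AlgebraicGeometry.HodgeTheory.ComplexTorusIntegralHodgeClassesCorrespondenceFunctoriality
import HarnessLib

/-!
# Contravariant functoriality of correspondences on integral Hodge classes: `(β ∘ α)^* = α^* ∘ β^*`

The second half of Fulton's Prop. 16.1.2 (a) for correspondences between complex tori acting on `Hdg•(−, ℤ)`: for
`α ∈ Hdgᵃ(X × Y, ℤ)`, `β ∈ Hdgᵇ(Y × Z, ℤ)`, `z ∈ Hdgˢ(Z, ℤ)`, with `α^*(b) = p_{X*}(α · p_Y^* b)` (Fulton Def. 16.1.2) and
`β ∘ α = p₁₃*(p₁₂^*α · p₂₃^*β)` (g27-#5's convention `X × (Y × Z)`):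

* **`integralHodgeClassesCorrComp_coact`** — `(β ∘ α)^*(z) = α^*(β^*(z))`.

Proof by transposition, as Fulton indicates ("(α')_* = α^*", "(β ∘ α)' = α' ∘ β'"): `(β ∘ α)^* = ((β ∘ α)')_* = (α' ∘ β')_* = (α')_* (β')_*
= α^* β^*`, using g27-#6 (`integralHodgeClassesPushforward_sndHom_swapHom_cup_pullbackHom_fstHom`,
`integralHodgeClassesPushforward_swapHom_corrComp`) and the covariant functoriality g27-#8 (`integralHodgeClassesCorrComp_act`) on
`Z × (Y × X)`; the auxiliary frames of `Z × X`, `Y × X`, `Z × Y`, `Z × (Y × X)` are transported from the given ones.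
Everything is proved; no named fact is introduced (D-0026).

## References

* [Fulton1998] W. Fulton, *Intersection Theory*, 2nd ed., Springer (1998), §16.1 Def. 16.1.1, Def. 16.1.2, Prop. 16.1.1 (b),
  Prop. 16.1.2 (a), (b) (p0293 L23, p0294 L21–L28, p0295 L9–L27, p0296 L1–L7).
* [Lange2023AbelianVarietiesComplex] H. Lange, *Abelian Varieties over the Complex Numbers*, Springer (2023), §6.2.2 (p0303 L19–L29),
  Lemma 6.2.8 (p0304 L1–L12).
-/

noncomputable section

open CategoryTheory Function

namespace Literature.AlgebraicGeometry.HodgeTheory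

open Literature.AlgebraicGeometry.Motives Literature.AlgebraicGeometry.Motives.HodgeStructure
open Literature.Geometry.Kaehler Literature.Geometry.Kaehler.ComplexTorus

namespace ComplexTorusCat

section Contravariance

variable {X Y Z : ComplexTorusCat} {gX gY gZ gXY gYZ gXZ gT : ℕ} (hgg₁ : gX + gY = gXY) (hgg₂ : gY + gZ = gYZ) (hggT : gXY + gZ = gT)
  (eX : Fin (2 * gX) ≃ X.toIsog.ι) (eY : Fin (2 * gY) ≃ Y.toIsog.ι) (eXY : Fin (2 * gXY) ≃ (prodObj X Y).toIsog.ι)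
  (eYZ : Fin (2 * gYZ) ≃ (prodObj Y Z).toIsog.ι) (eXZ : Fin (2 * gXZ) ≃ (prodObj X Z).toIsog.ι) (eT : Fin (2 * gT) ≃ (prodObj X (prodObj Y Z)).toIsog.ι)
  (hgX : gX + gX = 2 * gX) (hgY : gY + gY = 2 * gY) (hgXY : gXY + gXY = 2 * gXY) (hgYZ : gYZ + gYZ = 2 * gYZ) (hgXZ : gXZ + gXZ = 2 * gXZ)
  (hgT : gT + gT = 2 * gT)
  {s a b c₁ d ab m t₁ t₂ t₃ la lb L₁ L₂ l₃ L₄ : ℕ} (ht₁ : b + s = t₁) (ht₂ : a + c₁ = t₂) (hab : a + b = ab) (ht₃ : m + s = t₃)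
  (hla : la + 2 * a = 2 * gXY) (hlb : lb + 2 * b = 2 * gYZ)
  (k1 : L₁ + 2 * t₁ = 2 * gYZ) (k1' : L₁ + 2 * c₁ = 2 * gY) (k2 : L₂ + 2 * t₂ = 2 * gXY) (k2' : L₂ + 2 * d = 2 * gX)
  (h3 : l₃ + 2 * ab = 2 * gT) (h3' : l₃ + 2 * m = 2 * gXZ) (k4 : L₄ + 2 * t₃ = 2 * gXZ) (k4' : L₄ + 2 * d = 2 * gX)

include hgg₁ hgg₂ hggT hla hlb in
/-- **FULTON'S PROP. 16.1.2 (a), CONTRAVARIANT HALF: `(β ∘ α)^* = α^* ∘ β^*` on integral Hodge classes.** For `α ∈ Hdgᵃ(X × Y, ℤ)`,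
`β ∈ Hdgᵇ(Y × Z, ℤ)`, `z ∈ Hdgˢ(Z, ℤ)`, with `α^*(b) = p_{X*}(α · p_Y^*(b))` ("`α^*(b) = p_{X*}(α · p_Y^*(b))`", Def. 16.1.2) and
`β ∘ α = p₁₃*(p₁₂^*α · p₂₃^*β)`: `(β ∘ α)^*(z) = α^*(β^*(z))`. Proof by transposition: `α^* = (α')_*` (Prop. 16.1.2 (b), g27-#6),
`(β ∘ α)' = α' ∘ β'` (Prop. 16.1.1 (b), g27-#6) and `(α' ∘ β')_* = (α')_* ∘ (β')_*` (Prop. 16.1.2 (a) covariant, g27-#8, on `Z × (Y × X)`).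
[cite: Fulton1998, §16.1 Prop. 16.1.2 (a) "(β ∘ α)^* = α^* β^*", (b) "(α')_* = α^*" (p0295 L20–L26) and Prop. 16.1.1 (b) (p0293 L23)]
[cite: Lange2023AbelianVarietiesComplex, §6.2.2 Lemma 6.2.8 (p0304 L1–L12: "Z₂ ∘ Z₁(α) = Z₂(Z₁(α))") and (p0303 L19–L29)] -/
theorem integralHodgeClassesCorrComp_coact (α : integralHodgeClasses (prodObj X Y).toIsog.Φ a) (β : integralHodgeClasses (prodObj Y Z).toIsog.Φ b)
    (z : integralHodgeClasses Z.toIsog.Φ s) :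
    integralHodgeClassesPushforward t₃ d (fstHom X Z) eXZ eX k4 hgXZ k4' hgX
        (integralHodgeClassesCup (prodObj X Z).toIsog.Φ ht₃
          (integralHodgeClassesPushforward ab m (liftHom (fstHom X (prodObj Y Z)) (sndHom X (prodObj Y Z) ≫ sndHom Y Z)) eT eXZ h3 hgT h3' hgXZ
            (integralHodgeClassesCup (prodObj X (prodObj Y Z)).toIsog.Φ hab
              (integralHodgeClassesPullbackHom (liftHom (fstHom X (prodObj Y Z)) (sndHom X (prodObj Y Z) ≫ fstHom Y Z)) a α)
              (integralHodgeClassesPullbackHom (sndHom X (prodObj Y Z)) b β)))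
          (integralHodgeClassesPullbackHom (sndHom X Z) s z)) =
      integralHodgeClassesPushforward t₂ d (fstHom X Y) eXY eX k2 hgXY k2' hgX
        (integralHodgeClassesCup (prodObj X Y).toIsog.Φ ht₂ α
          (integralHodgeClassesPullbackHom (sndHom X Y) c₁
            (integralHodgeClassesPushforward t₁ c₁ (fstHom Y Z) eYZ eY k1 hgYZ k1' hgY
              (integralHodgeClassesCup (prodObj Y Z).toIsog.Φ ht₁ β (integralHodgeClassesPullbackHom (sndHom Y Z) s z))))) := by
  rw [← integralHodgeClassesPushforward_sndHom_swapHom_cup_pullbackHom_fstHom eX eXZ (eXZ.trans (Equiv.sumComm _ _)) hgX hgXZ ht₃ h3' k4 k4',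
    integralHodgeClassesPushforward_swapHom_corrComp eXY (eXY.trans (Equiv.sumComm _ _)) eYZ (eYZ.trans (Equiv.sumComm _ _)) eXZ
      (eXZ.trans (Equiv.sumComm _ _)) eT
      (eT.trans ((Equiv.sumAssoc _ _ _).symm.trans ((Equiv.sumComm _ _).trans (Equiv.sumCongr (Equiv.refl _) (Equiv.sumComm _ _)))))
      hgXY hgYZ hgXZ hgT hab hla hlb h3 h3' α β,
    integralHodgeClassesCorrComp_act (by omega : gY + gX = gXY) (by omega : gYZ + gX = gT) eY eX (eYZ.trans (Equiv.sumComm _ _))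
      (eXY.trans (Equiv.sumComm _ _)) (eXZ.trans (Equiv.sumComm _ _))
      (eT.trans ((Equiv.sumAssoc _ _ _).symm.trans ((Equiv.sumComm _ _).trans (Equiv.sumCongr (Equiv.refl _) (Equiv.sumComm _ _)))))
      hgY hgX hgYZ hgXY hgXZ hgT ht₁ ht₂ (show b + a = ab by omega) ht₃ k1 k1' k2 k2' h3 h3' k4 k4',
    integralHodgeClassesPushforward_sndHom_swapHom_cup_pullbackHom_fstHom eY eYZ (eYZ.trans (Equiv.sumComm _ _)) hgY hgYZ ht₁ hlb k1 k1',
    integralHodgeClassesPushforward_sndHom_swapHom_cup_pullbackHom_fstHom eX eXY (eXY.trans (Equiv.sumComm _ _)) hgX hgXY ht₂ hla k2 k2']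

end Contravariance

end ComplexTorusCat

end Literature.AlgebraicGeometry.HodgeTheory
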